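import Literature.MathematicalPhysics.KineticTheory.ReyBelletThomas2002Semigroup
import Literature.MathematicalPhysics.KineticTheory.MarkovSemigroupForwardEquation
import HarnessLib

/-!
# Rey-Bellet–Thomas 2002: the Fokker–Planck equation of the heat-conduction chain in `𝓓'((0,∞) × X)`

Trunk T-KINETIC (Literature/MathematicalPhysics/KineticTheory). Inline decomposition step for the
named fact `ReyBelletThomas2002_thm21` (provefact unit), toward its "`C^∞` law" clause (§4 p. 26:
"the Markov process has a `C^∞` law … a consequence of Hörmander Theorem", i.e. hypoellipticity of
`∂_t - L` applied to the forward equation). The abstract forward equation of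
`MarkovSemigroupForwardEquation.lean` asks that `L` act smoothly on smooth compactly supported
one-parameter families; here this is PROVED for the generator `L` of RBT eq. (13) with smooth
potentials and `γT_b ≥ 0`, through its Itô form `L f = Df·X₀ + ½∑_b D²f[v_b, v_b]`
(`rbGenerator_eq_sdeGenerator`):

* `fderiv_spaceSlice_apply`, `fderiv_fderiv_spaceSlice_apply` — derivatives of the slices
  `y ↦ Ψ(t, y)` are slices of derivatives of `Ψ` along `(0, v)`;
* `OscillatorChain.rbGenerator_family_eq` — `L(Ψ(t,·))(y) = DΨ(t,y)·(0, X₀(y)) + ½∑_b D[DΨ·(0,v_b)](t,y)·(0,v_b)`;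
* `OscillatorChain.rbGenerator_actsOnFamilies` — `(t, y) ↦ L(Ψ(t,·))(y)` is `C_c^∞` for `Ψ ∈ C_c^∞`;
* `OscillatorChain.rb_forwardEquation` — **for every `S : MarkovSemigroupFor (P.rbGenerator Λ N T_L T_R)`,
  every `x` and every `Ψ ∈ C_c^∞(ℝ × X)` supported in `(0,∞) × X`:
  `∫_0^∞ ∫ (∂_tΨ + L_yΨ)(t, y) P_t(x, dy) dt = 0`.**

## References

* L. Rey-Bellet, L. E. Thomas, Comm. Math. Phys. 225 (2002) 305–329, §2 eq. (13), §4.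
-/

noncomputable section

open MeasureTheory ProbabilityTheory Filter Topology Set
open scoped NNReal ENNReal ContDiff

namespace Literature.MathematicalPhysics.KineticTheory.HeatConduction

/-! ### Derivatives of space slices -/

section Slices

variable {X : Type*} [NormedAddCommGroup X] [NormedSpace ℝ X] {Ψ : ℝ × X → ℝ}

/-- `D_y[Ψ(t,·)](y)·w = DΨ(t,y)·(0,w)`. [folklore] -/
theorem fderiv_spaceSlice_apply (hΨ : Differentiable ℝ Ψ) (t : ℝ) (y w : X) :
    fderiv ℝ (fun y' => Ψ (t, y')) y w = fderiv ℝ Ψ (t, y) (0, w) := by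
  have h1 : HasFDerivAt (fun y' : X => ((t, y') : ℝ × X))
      ((0 : X →L[ℝ] ℝ).prod (ContinuousLinearMap.id ℝ X)) y :=
    (hasFDerivAt_const t y).prodMk (hasFDerivAt_id y)
  have h2 : HasFDerivAt (fun y' : X => Ψ (t, y'))
      ((fderiv ℝ Ψ (t, y)).comp ((0 : X →L[ℝ] ℝ).prod (ContinuousLinearMap.id ℝ X))) y :=
    (hΨ (t, y)).hasFDerivAt.comp y h1
  rw [h2.fderiv]
  simp

/-- `D²_y[Ψ(t,·)](y)[v,v] = D[q ↦ DΨ(q)·(0,v)](t,y)·(0,v)` for `Ψ ∈ C²`. [folklore] -/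
theorem fderiv_fderiv_spaceSlice_apply (hΨ : ContDiff ℝ 2 Ψ) (t : ℝ) (y v : X) :
    fderiv ℝ (fderiv ℝ (fun y' => Ψ (t, y'))) y v v =
      fderiv ℝ (fun q : ℝ × X => fderiv ℝ Ψ q (0, v)) (t, y) (0, v) := by
  have hd : Differentiable ℝ Ψ := hΨ.differentiable (by norm_num)
  have hft : ContDiff ℝ 2 (fun y' => Ψ (t, y')) := hΨ.comp (contDiff_const.prodMk contDiff_id)
  have hdft : Differentiable ℝ (fderiv ℝ (fun y' => Ψ (t, y'))) :=
    (hft.fderiv_right (m := 1) (by norm_num)).differentiable one_ne_zero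
  have h1 : fderiv ℝ (fun y' => fderiv ℝ (fun y'' => Ψ (t, y'')) y' v) y v =
      fderiv ℝ (fderiv ℝ (fun y' => Ψ (t, y'))) y v v := by
    rw [fderiv_clm_apply (hdft y) (differentiableAt_const v)]
    simp
  have h2 : (fun y' => fderiv ℝ (fun y'' => Ψ (t, y'')) y' v) =
      fun y' => (fun q : ℝ × X => fderiv ℝ Ψ q (0, v)) (t, y') :=
    funext fun y' => fderiv_spaceSlice_apply hd t y' v
  have hA : Differentiable ℝ (fun q : ℝ × X => fderiv ℝ Ψ q (0, v)) :=
    ((hΨ.fderiv_right (m := 1) (by norm_num)).clm_apply contDiff_const).differentiable one_ne_zero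
  rw [← h1, h2, fderiv_spaceSlice_apply hA t y v]

end Slices

/-! ### The generator of RBT eq. (13) acts smoothly on smooth compactly supported families -/

namespace OscillatorChain

variable (P : OscillatorChain) {N : ℕ}

/-- **`L(Ψ(t,·))(y)` in terms of `Ψ` on `ℝ × X`**: for `γT_L, γT_R ≥ 0` and
`Ψ ∈ C^∞(ℝ × X)`,
`L(Ψ(t,·))(y) = DΨ(t,y)·(0, X₀(y)) + ½ ∑_b D[q ↦ DΨ(q)·(0,v_b)](t,y)·(0,v_b)` (Itô form of `L`,
`rbGenerator_eq_sdeGenerator`, read through the slices). [cite: ReyBelletThomas2002, §2 eq. (13)] -/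
theorem rbGenerator_family_eq (Λ : ℝ) {T_L T_R : ℝ}
    (hL : 0 ≤ P.γ * T_L) (hR : 0 ≤ P.γ * T_R) {Ψ : ℝ × RBPhaseSpace N → ℝ} (hΨ : ContDiff ℝ ∞ Ψ) :
    (fun p : ℝ × RBPhaseSpace N => P.rbGenerator Λ N T_L T_R (fun y => Ψ (p.1, y)) p.2) =
      fun p => fderiv ℝ Ψ p (0, P.rbDrift Λ N p.2) +
        (1 / 2) * (fderiv ℝ (fun q : ℝ × RBPhaseSpace N => fderiv ℝ Ψ q (0, P.rbNoiseVec N T_L T_R 0)) p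
            (0, P.rbNoiseVec N T_L T_R 0) +
          fderiv ℝ (fun q : ℝ × RBPhaseSpace N => fderiv ℝ Ψ q (0, P.rbNoiseVec N T_L T_R 1)) p
            (0, P.rbNoiseVec N T_L T_R 1)) := by
  funext p
  obtain ⟨t, y⟩ := p
  have hΨ2 : ContDiff ℝ 2 Ψ := hΨ.of_le (by norm_cast)
  have h2 : ContDiff ℝ 2 (fun y' => Ψ (t, y')) := hΨ2.comp (contDiff_const.prodMk contDiff_id)
  rw [P.rbGenerator_eq_sdeGenerator Λ hL hR h2, sdeGenerator]
  simp only
  rw [fderiv_spaceSlice_apply (hΨ.differentiable (by simp)) t y,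
    fderiv_fderiv_spaceSlice_apply hΨ2 t y, fderiv_fderiv_spaceSlice_apply hΨ2 t y]

/-- **The generator `L` of RBT eq. (13) acts smoothly on smooth compactly supported one-parameter
families**: `(t, y) ↦ L(Ψ(t,·))(y)` is `C^∞` with compact support on `ℝ × X` for every
`Ψ ∈ C_c^∞(ℝ × X)` (smooth potentials, `γT_L, γT_R ≥ 0`) — the hypothesis of the abstract forward
equation `MarkovSemigroupFor.forwardEquation`. [folklore] -/
theorem rbGenerator_actsOnFamilies (hU : ContDiff ℝ ∞ P.U) (hV : ContDiff ℝ ∞ P.V) (Λ : ℝ) {T_L T_R : ℝ}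
    (hL : 0 ≤ P.γ * T_L) (hR : 0 ≤ P.γ * T_R) :
    ∀ Ψ : ℝ × RBPhaseSpace N → ℝ, ContDiff ℝ ∞ Ψ → HasCompactSupport Ψ →
      ContDiff ℝ ∞ (fun p : ℝ × RBPhaseSpace N => P.rbGenerator Λ N T_L T_R (fun y => Ψ (p.1, y)) p.2) ∧
      HasCompactSupport (fun p : ℝ × RBPhaseSpace N => P.rbGenerator Λ N T_L T_R (fun y => Ψ (p.1, y)) p.2) := by
  intro Ψ hΨ hΨc
  rw [P.rbGenerator_family_eq Λ hL hR hΨ]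
  have hYs : ContDiff ℝ ∞ (P.rbDrift Λ N) := P.contDiff_rbDrift hU hV Λ N
  have hD : ContDiff ℝ ∞ (fderiv ℝ Ψ) := hΨ.fderiv_right (m := ∞) (by exact_mod_cast le_top)
  have hA : ∀ v : RBPhaseSpace N, ContDiff ℝ ∞ (fun q : ℝ × RBPhaseSpace N => fderiv ℝ Ψ q (0, v)) :=
    fun v => hD.clm_apply contDiff_const
  have hA' : ∀ v : RBPhaseSpace N, ContDiff ℝ ∞ (fun p : ℝ × RBPhaseSpace N =>
      fderiv ℝ (fun q : ℝ × RBPhaseSpace N => fderiv ℝ Ψ q (0, v)) p (0, v)) := fun v =>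
    ((hA v).fderiv_right (m := ∞) (by exact_mod_cast le_top)).clm_apply contDiff_const
  have h1 : ContDiff ℝ ∞ (fun p : ℝ × RBPhaseSpace N => fderiv ℝ Ψ p (0, P.rbDrift Λ N p.2)) :=
    hD.clm_apply (contDiff_const.prodMk (hYs.comp contDiff_snd))
  refine ⟨h1.add (contDiff_const.mul ((hA' _).add (hA' _))), ?_⟩
  refine hΨc.mono' fun p hp => by_contra fun hnot => hp ?_
  have h0 : fderiv ℝ Ψ p = 0 := Function.notMem_support.1 fun h => hnot (support_fderiv_subset ℝ h)
  have hA0 : ∀ v : RBPhaseSpace N,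
      fderiv ℝ (fun q : ℝ × RBPhaseSpace N => fderiv ℝ Ψ q (0, v)) p = 0 := fun v =>
    Function.notMem_support.1 fun h =>
      hnot (tsupport_fderiv_apply_subset ℝ (0, v) (support_fderiv_subset ℝ h))
  simp [h0, hA0]

/-- **The forward (Fokker–Planck) equation of (RBT-SDE) in `𝓓'((0,∞) × X)`**: for smooth
potentials, `γT_L, γT_R ≥ 0`, every `S : MarkovSemigroupFor (P.rbGenerator Λ N T_L T_R)` (in
particular the constructed `rbSemigroup`), every starting point `x` and every test function
`Ψ ∈ C_c^∞(ℝ × X)` supported in `(0, ∞) × X`: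
`∫_0^∞ ∫ (∂_tΨ(t, y) + L_yΨ(t, y)) P_t(x, dy) dt = 0` — the equation to which §4 applies
Hörmander's theorem for `∂_t - L`. [cite: ReyBelletThomas2002, §4] -/
theorem rb_forwardEquation (hU : ContDiff ℝ ∞ P.U) (hV : ContDiff ℝ ∞ P.V) {Λ : ℝ} {T_L T_R : ℝ}
    (hL : 0 ≤ P.γ * T_L) (hR : 0 ≤ P.γ * T_R) (S : MarkovSemigroupFor (P.rbGenerator Λ N T_L T_R))
    {Ψ : ℝ × RBPhaseSpace N → ℝ} (hΨ : ContDiff ℝ ∞ Ψ) (hΨc : HasCompactSupport Ψ)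
    (hΨ0 : tsupport Ψ ⊆ Set.Ioi (0 : ℝ) ×ˢ Set.univ) (x : RBPhaseSpace N) :
    ∫ t in Set.Ioi (0 : ℝ), S.act t.toNNReal
      (fun y => fderiv ℝ Ψ (t, y) (1, 0) + P.rbGenerator Λ N T_L T_R (fun y' => Ψ (t, y')) y) x = 0 :=
  S.forwardEquation (P.rbGenerator_actsOnFamilies hU hV Λ hL hR) hΨ hΨc hΨ0 x

end OscillatorChain

end Literature.MathematicalPhysics.KineticTheory.HeatConduction
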